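/-
Fleet lead `ym-wcr-19609-p1` (seat prover-ym-wcr-19609-p1-g2-0), route `WeakCouplingRates`, crux `BulkDominatesColdBoxW`
(stmt-QuantumFields-19609), line `dlr-chessboard` (v6): the «∃ ϑ s + energy» half of `KernelMeanExpansion` / `KernelCovExpansion`.
-/
import Summits.QuantumFields.YangMills.Theorems.WeakCouplingRatesBulkDominatesColdBoxWLinearisedDatumEnergy
import Summits.QuantumFields.YangMills.Theorems.WeakCouplingRatesBulkDominatesColdBoxWSmallLinksDatum
import Summits.QuantumFields.YangMills.Theorems.WeakCouplingRatesBulkDominatesColdBoxWForestGaugeDatum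

/-!
# Crux `BulkDominatesColdBoxW`: the COMPETITOR of a crude-good datum — a small forest-gauged gauge copy on the enlarged box, its gnomonic
# coordinates, and the energy bound `Σ_c M_{ϑ_c}(s_c) ≤ #P·(β^{2δ−1} + 362 m³)`

The interfaces `KernelMeanExpansion θ δ` / `KernelCovExpansion A θ δ` (`Theorems/WeakCouplingRatesBulkDominatesColdBoxWDefs.lean`) ask, for every
crude-good datum `ω`, for one-colour data `ϑ c` and competitors `s c` of total energy `≤ 16(2H+3)⁴β^{2δ−1}` — the data being, in the assembly, the
gnomonic coordinates of the datum actually seen by the forest-gauged kernel.  This file CONSTRUCTS them (census v3, item evidence #12):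

* `truncDatum E ω` is NOT a definition here — we work with `glueWith E (ω ∘ val) 1` inline: the gauge copy `ω^g` of B4
  (`exists_gauge_opDist1_le_of_crudeGood`: all links of the enlarged box `E = boxEdgesAt dirCorner (2H+3)` within `r₀ = 4(2H+3)√(2β^{2δ−1})` of `1`)
  truncated to `1` off `E`, then forest-gauged: `W = forestFix H (glueWith E (ω^g|_E) 1)`;
* `opDist1_plaquette_le_four_mul` — a configuration all of whose links are within `r` of `1` has all plaquette holonomies within `4r`, hence
  (`cost = |U−1|²_op` on `SU(2)`, `cost_eq_opDist1_sq`) all costs `≤ 16r²`;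
* `forestFix_apply_of_not_mem_boxEdges` — the forest gauge does not move exterior links; with `su2_opDist1_le_uniform_of_exterior_le` every link of
  `W` is within `m₀ = 10(12H²+2H+1)·r₀` of `1` (`forestFix_links_le`);
* `plaqCostAt_forestFix_trunc_eq` — on the plaquettes of the enlarged box the costs of `W` are those of `ω` (gauge invariance twice), `≤ β^{2δ−1}`;
* **`exists_datum_coords_energy_le`** — for `m₀ ≤ 1/6`: there are `g` and coordinates `v` with `W e = gnomonicChart (v e)`, `Σ_c v_{e,c}² ≤ 2m₀²` on
  `E`, and `Σ_c M_{v_c}(v_c) ≤ #P·(β^{2δ−1} + 362(√2·m₀)³)` (`exists_gnomonic_coords`, `sum_formM_coords_le`), `#P ≤ ` the plaquette labels of the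
  enlarged box.  In the line's bookkeeping `m₀ ≍ H³β^{δ−1/2}` and `#P·362(√2 m₀)³ ≤ #P·β^{2δ−1}` eventually, `#P ≤ 6(2H+3)⁴`.

No new definition; standard axioms.  NOT a claim about the mass gap.
-/

set_option autoImplicit false

noncomputable section

open Finset
open scoped Matrix.Norms.L2Operator
open Literature.Probability.LatticeModels Literature.MathematicalPhysics Literature.MathematicalPhysics.QuantumLattice
open Literature.MathematicalPhysics.QuantumFieldTheory Literature.MathematicalPhysics.QuantumFieldTheory.AxialGauge
open Literature.MathematicalPhysics.QuantumFieldTheory.LatticeMaxwell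
open Literature.MathematicalPhysics.QuantumFieldTheory.Balaban1983to89 Literature.MathematicalPhysics.QuantumFieldTheory.Balaban1983to89.UnitaryModel

namespace Summit.QuantumFields.YangMills.Theorems.WeakCouplingRates

/-! ## §1 `SU(2)`: cost `= |U − 1|²_op`; plaquettes of a configuration with small links -/

/-- On `SU(2)` the Wilson cost IS the squared operator distance to `1`: `2 − Re tr U = ‖U − 1‖²_op`. -/
theorem cost_eq_opDist1_sq (U : Matrix.specialUnitaryGroup (Fin 2) ℂ) :
    2 - (fundamentalRep (Fin 2) U).trace.re = opDist1 (fundamentalRep (Fin 2) U) ^ 2 := by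
  have h := MatrixNorms.opDist1_sq_eq_of_mem_specialUnitaryGroup_two (U := fundamentalRep (Fin 2) U) U.2
  simp only [nReTr, Fintype.card_fin, Nat.cast_ofNat] at h
  rw [h]; ring

/-- A plaquette holonomy is within `ℓ₁ + ℓ₂ + ℓ₃ + ℓ₄` of `1` (lengths of its four links). -/
theorem opDist1_plaquette_le (U : LGConfig 4 (Matrix.specialUnitaryGroup (Fin 2) ℂ)) (x : Site 4) (i j : Fin 4) :
    opDist1 (fundamentalRep (Fin 2) (plaquetteHolonomyZd U x i j)) ≤
      opDist1 (fundamentalRep (Fin 2) (U (x, i))) + opDist1 (fundamentalRep (Fin 2) (U (x + Pi.single i 1, j))) +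
        opDist1 (fundamentalRep (Fin 2) (U (x + Pi.single j 1, i))) + opDist1 (fundamentalRep (Fin 2) (U (x, j))) := by
  have hρu : ∀ g : Matrix.specialUnitaryGroup (Fin 2) ℂ, fundamentalRep (Fin 2) g ∈ Matrix.unitaryGroup (Fin 2) ℂ :=
    fundamentalRep_mem_unitaryGroup
  unfold plaquetteHolonomyZd
  calc opDist1 (fundamentalRep (Fin 2) (U (x, i) * U (x + Pi.single i 1, j) * (U (x + Pi.single j 1, i))⁻¹ * (U (x, j))⁻¹))
      ≤ opDist1 (fundamentalRep (Fin 2) (U (x, i) * U (x + Pi.single i 1, j) * (U (x + Pi.single j 1, i))⁻¹)) +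
          opDist1 (fundamentalRep (Fin 2) (U (x, j))⁻¹) := opDist1_map_mul_le _ hρu _ _
    _ ≤ (opDist1 (fundamentalRep (Fin 2) (U (x, i) * U (x + Pi.single i 1, j))) +
          opDist1 (fundamentalRep (Fin 2) (U (x + Pi.single j 1, i))⁻¹)) + opDist1 (fundamentalRep (Fin 2) (U (x, j))⁻¹) := by
        gcongr; exact opDist1_map_mul_le _ hρu _ _
    _ ≤ ((opDist1 (fundamentalRep (Fin 2) (U (x, i))) + opDist1 (fundamentalRep (Fin 2) (U (x + Pi.single i 1, j)))) +
          opDist1 (fundamentalRep (Fin 2) (U (x + Pi.single j 1, i))⁻¹)) + opDist1 (fundamentalRep (Fin 2) (U (x, j))⁻¹) := by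
        gcongr; exact opDist1_map_mul_le _ hρu _ _
    _ = _ := by rw [opDist1_map_inv _ hρu, opDist1_map_inv _ hρu]

/-- **Small links ⇒ small plaquettes**: if every link is within `r` of `1`, every plaquette cost is `≤ 16r²`. -/
theorem plaqCostAt_le_of_links_le (U : LGConfig 4 (Matrix.specialUnitaryGroup (Fin 2) ℂ)) {r : ℝ} (hr : 0 ≤ r)
    (hU : ∀ e, opDist1 (fundamentalRep (Fin 2) (U e)) ≤ r) (x : Site 4) (i j : Fin 4) :
    plaqCostAt (fundamentalRep (Fin 2)) x i j U ≤ 16 * r ^ 2 := by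
  have h4 : opDist1 (fundamentalRep (Fin 2) (plaquetteHolonomyZd U x i j)) ≤ 4 * r := by
    have := opDist1_plaquette_le U x i j
    linarith [hU (x, i), hU (x + Pi.single i 1, j), hU (x + Pi.single j 1, i), hU (x, j)]
  have hcost : plaqCostAt (fundamentalRep (Fin 2)) x i j U = opDist1 (fundamentalRep (Fin 2) (plaquetteHolonomyZd U x i j)) ^ 2 := by
    simp only [plaqCostAt, plaquetteObs, Nat.cast_ofNat]
    exact cost_eq_opDist1_sq _
  rw [hcost]
  have h0 := opDist1_nonneg (fundamentalRep (Fin 2) (plaquetteHolonomyZd U x i j))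
  nlinarith

/-! ## §2 The forest gauge does not move exterior links; gauge invariance of plaquette costs -/

variable {H : ℕ}

/-- Off the cold box the forest-gauged configuration equals the original one (both endpoints are non-interior vertices). -/
theorem forestFix_apply_of_not_mem_boxEdges {G : Type*} [Group G] (U : LGConfig 4 G)
    {e : Literature.MathematicalPhysics.QuantumLattice.ZdEdge 4} (he : e ∉ boxEdges 4 (2 * H + 1)) : forestFix H U e = U e := by
  obtain ⟨x, i⟩ := e
  obtain ⟨h1, h2⟩ := not_interior_of_not_mem_boxEdges (H := H) he
  rw [forestFix_apply, forestGauge_of_not_interior _ h1, forestGauge_of_not_interior _ h2]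
  group

/-- Plaquette costs are gauge invariant. -/
theorem plaqCostAt_gaugeTransformZd {G : Type*} [Group G] {N : ℕ} (ρ : G →* Matrix (Fin N) (Fin N) ℂ) (g : Site 4 → G)
    (U : LGConfig 4 G) (x : Site 4) (i j : Fin 4) :
    plaqCostAt ρ x i j (gaugeTransformZd g U) = plaqCostAt ρ x i j U := by
  simp only [plaqCostAt, isZdGaugeInvariant_plaquetteObs ρ x i j g U]

/-- Plaquette costs of the forest-gauged configuration are those of the original one. -/
theorem plaqCostAt_forestFix {N : ℕ} {G : Type*} [Group G] (ρ : G →* Matrix (Fin N) (Fin N) ℂ) (U : LGConfig 4 G) (x : Site 4) (i j : Fin 4) :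
    plaqCostAt ρ x i j (forestFix H U) = plaqCostAt ρ x i j U :=
  plaqCostAt_gaugeTransformZd ρ _ U x i j

/-! ## §3 The truncated gauge copy and its forest gauge: link and plaquette bounds -/

/-- Links of the truncation `glueWith E (U|_E) 1` are within `r` of `1` if those of `U` on `E` are (`r ≥ 0`). -/
theorem opDist1_trunc_le (E : Finset (Literature.MathematicalPhysics.QuantumLattice.ZdEdge 4))
    (U : LGConfig 4 (Matrix.specialUnitaryGroup (Fin 2) ℂ)) {r : ℝ} (hr : 0 ≤ r)
    (hU : ∀ e ∈ E, opDist1 (fundamentalRep (Fin 2) (U e)) ≤ r) (e : Literature.MathematicalPhysics.QuantumLattice.ZdEdge 4) :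
    opDist1 (fundamentalRep (Fin 2) (glueWith E (fun e' : ↥E => U e'.1) (fun _ => 1) e)) ≤ r := by
  by_cases he : e ∈ E
  · rw [glueWith_apply_mem _ _ _ he]; exact hU e he
  · rw [glueWith_apply_not_mem _ _ _ he, map_one, UnitaryModel.opDist1_one]; exact hr

/-- **All links of the forest-gauged truncated copy are small**: with `E ⊇` the cold box's exterior collar irrelevant — for ANY finite `E`, if
the links of `U` on `E` are within `r ≥ 0` of `1`, then every link of `W = forestFix H (glueWith E (U|_E) 1)` is within
`(12H²+2H+1)(√(2·16r²) + 4r)` of `1` (`H ≥ 1`). -/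
theorem forestFix_trunc_links_le (hH : 1 ≤ H) (E : Finset (Literature.MathematicalPhysics.QuantumLattice.ZdEdge 4))
    (U : LGConfig 4 (Matrix.specialUnitaryGroup (Fin 2) ℂ)) {r : ℝ} (hr : 0 ≤ r)
    (hU : ∀ e ∈ E, opDist1 (fundamentalRep (Fin 2) (U e)) ≤ r) (e : Literature.MathematicalPhysics.QuantumLattice.ZdEdge 4) :
    opDist1 (fundamentalRep (Fin 2) (forestFix H (glueWith E (fun e' : ↥E => U e'.1) (fun _ => 1)) e)) ≤
      (12 * (H : ℝ) ^ 2 + 2 * H + 1) * (Real.sqrt (2 * (16 * r ^ 2)) + 4 * r) := by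
  set V := glueWith E (fun e' : ↥E => U e'.1) (fun _ => (1 : Matrix.specialUnitaryGroup (Fin 2) ℂ)) with hV
  have hVr : ∀ e', opDist1 (fundamentalRep (Fin 2) (V e')) ≤ r := opDist1_trunc_le E U hr hU
  refine su2_opDist1_le_uniform_of_exterior_le hH (forestFix H V) hr ?_ ?_ ?_ e
  · intro e' he'
    rw [forestFix_apply_of_not_mem_boxEdges V he']; exact hVr e'
  · intro x hx; exact forestFix_forest V hx
  · intro x i j
    have h := plaqCostAt_le_of_links_le V hr hVr x i j
    rw [← plaqCostAt_forestFix (fundamentalRep (Fin 2)) V x i j] at h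
    simpa only [plaqCostAt, plaquetteObs, Nat.cast_ofNat] using h

/-- **On the plaquettes of the enlarged box the costs of the forest-gauged truncated gauge copy are those of the datum**. -/
theorem plaqCostAt_forestFix_trunc_gauge_eq (g : Site 4 → Matrix.specialUnitaryGroup (Fin 2) ℂ)
    (ω : LGConfig 4 (Matrix.specialUnitaryGroup (Fin 2) ℂ)) {p : Plaq 4} (hp : p ∈ plaquettesIn (halfOpenBox 4 (2 * H + 3))) :
    plaqCostAt (fundamentalRep (Fin 2)) (Plaq.shift dirCorner p).1 (Plaq.shift dirCorner p).2.1 (Plaq.shift dirCorner p).2.2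
        (forestFix H (glueWith (boxEdgesAt dirCorner (2 * H + 3))
          (fun e' : ↥(boxEdgesAt dirCorner (2 * H + 3)) => gaugeTransformZd g ω e'.1) (fun _ => 1))) =
      plaqCostAt (fundamentalRep (Fin 2)) (Plaq.shift dirCorner p).1 (Plaq.shift dirCorner p).2.1 (Plaq.shift dirCorner p).2.2 ω := by
  obtain ⟨e1, e2, e3, e4⟩ := shift_edges_mem_boxEdgesAt (a := dirCorner) hp
  rw [plaqCostAt_forestFix, plaqCostAt_congr (fundamentalRep (Fin 2)) _ _ _ (U' := gaugeTransformZd g ω)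
    (glueWith_apply_mem _ _ _ e1) (glueWith_apply_mem _ _ _ e2) (glueWith_apply_mem _ _ _ e3) (glueWith_apply_mem _ _ _ e4),
    plaqCostAt_gaugeTransformZd]

/-! ## §4 The competitor of a crude-good datum -/

/-- The base point of a plaquette label of the enlarged box, translated by `dirCorner`, lies in the corona range `[−1, 2H+1]⁴`. -/
theorem shift_fst_mem_corona {p : Plaq 4} (hp : p ∈ plaquettesIn (halfOpenBox 4 (2 * H + 3))) (k : Fin 4) :
    (-1 : ℤ) ≤ (Plaq.shift dirCorner p).1 k ∧ (Plaq.shift dirCorner p).1 k ≤ 2 * (H : ℤ) + 1 := by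
  have hx := (Plaq.mem_plaquettesIn.1 hp).1
  rw [mem_halfOpenBox] at hx
  have := hx k
  simp only [Plaq.shift_fst, Pi.add_apply, dirCorner]
  push_cast at this ⊢; omega

/-- **The competitor of a crude-good datum.**  Let `ω` be crude-good at scale `β^{2δ−1}` for the box `H ≥ 1`, and suppose the
small-link radius `m₀ = (12H²+2H+1)(√(2·16r₀²) + 4r₀)`, `r₀ = 4(2H+3)√(2β^{2δ−1})`, satisfies `m₀ ≤ 1/6`.  Then there are a gauge `g` and
coordinates `v : edges → ℝ³` such that the forest-gauged truncated gauge copy `W = forestFix H (glueWith E ((ω^g)|_E) 1)`,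
`E = boxEdgesAt dirCorner (2H+3)`, agrees with the chart points `gnomonicChart (v e)` on `E`, `Σ_c v_{e,c}² ≤ 2m₀²` on `E`, and the three one-colour
Maxwell forms of the coordinate components obey `Σ_c M_{v_c}(v_c) ≤ #P·(β^{2δ−1} + 362(√2·m₀)³)`, `P` = plaquette labels of the enlarged box. -/
theorem exists_datum_coords_energy_le (hH : 1 ≤ H) {β δ : ℝ} {ω : LGConfig 4 (Matrix.specialUnitaryGroup (Fin 2) ℂ)}
    (hω : CrudeGood β δ H ω)
    (hm : (12 * (H : ℝ) ^ 2 + 2 * H + 1) *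
        (Real.sqrt (2 * (16 * (4 * (2 * H + 3 : ℕ) * Real.sqrt (2 * β ^ (2 * δ - 1))) ^ 2)) +
          4 * (4 * (2 * H + 3 : ℕ) * Real.sqrt (2 * β ^ (2 * δ - 1)))) ≤ 1 / 6) :
    ∃ (g : Site 4 → Matrix.specialUnitaryGroup (Fin 2) ℂ) (v : Literature.MathematicalPhysics.QuantumLattice.ZdEdge 4 → Fin 3 → ℝ),
      (∀ e ∈ boxEdgesAt dirCorner (2 * H + 3),
        forestFix H (glueWith (boxEdgesAt dirCorner (2 * H + 3))
          (fun e' : ↥(boxEdgesAt dirCorner (2 * H + 3)) => gaugeTransformZd g ω e'.1) (fun _ => 1)) e = gnomonicChart (v e)) ∧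
      (∀ e ∈ boxEdgesAt dirCorner (2 * H + 3), ∑ c, v e c ^ 2 ≤
        2 * ((12 * (H : ℝ) ^ 2 + 2 * H + 1) *
          (Real.sqrt (2 * (16 * (4 * (2 * H + 3 : ℕ) * Real.sqrt (2 * β ^ (2 * δ - 1))) ^ 2)) +
            4 * (4 * (2 * H + 3 : ℕ) * Real.sqrt (2 * β ^ (2 * δ - 1))))) ^ 2) ∧
      ∑ c : Fin 3, formM (fun e => e ∉ dirFreeEdges H) dirCorner (2 * H + 3) (fun e => v e c) (fun e' : DirFree H => v e'.1.1 c) ≤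
        (plaquettesIn (halfOpenBox 4 (2 * H + 3))).card *
          (β ^ (2 * δ - 1) + 362 * (Real.sqrt 2 * ((12 * (H : ℝ) ^ 2 + 2 * H + 1) *
            (Real.sqrt (2 * (16 * (4 * (2 * H + 3 : ℕ) * Real.sqrt (2 * β ^ (2 * δ - 1))) ^ 2)) +
              4 * (4 * (2 * H + 3 : ℕ) * Real.sqrt (2 * β ^ (2 * δ - 1)))))) ^ 3) := by
  classical
  set r₀ : ℝ := 4 * (2 * H + 3 : ℕ) * Real.sqrt (2 * β ^ (2 * δ - 1)) with hr₀
  set m₀ : ℝ := (12 * (H : ℝ) ^ 2 + 2 * H + 1) * (Real.sqrt (2 * (16 * r₀ ^ 2)) + 4 * r₀) with hm₀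
  have hr₀0 : 0 ≤ r₀ := by rw [hr₀]; positivity
  have hm₀0 : 0 ≤ m₀ := by rw [hm₀]; positivity
  set E := boxEdgesAt dirCorner (2 * H + 3) with hE
  -- the gauge copy of B4
  obtain ⟨g, hg⟩ := exists_gauge_opDist1_le_of_crudeGood hω
  set ω₁ := gaugeTransformZd g ω with hω₁
  have hω₁E : ∀ e ∈ E, opDist1 (fundamentalRep (Fin 2) (ω₁ e)) ≤ r₀ := by
    rintro ⟨x, i⟩ he
    have hmem := (mem_boxEdgesAt.1 he)
    simp only at hmem
    have h := hg (x - dirCorner) i hmem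
    have hx : x - dirCorner - (fun _ => (1 : ℤ)) = x := by
      funext k; simp [dirCorner]
    rw [hx] at h
    exact h
  set W := forestFix H (glueWith E (fun e' : ↥E => ω₁ e'.1) (fun _ => 1)) with hW
  -- all links of `W` within `m₀`
  have hWm : ∀ e, opDist1 (fundamentalRep (Fin 2) (W e)) ≤ m₀ := fun e => forestFix_trunc_links_le hH E ω₁ hr₀0 hω₁E e
  -- coordinates
  have hm₀' : m₀ ≤ 1 / 6 := hm
  have hcostW : ∀ e, 2 - ((W e : Matrix.specialUnitaryGroup (Fin 2) ℂ) : Matrix (Fin 2) (Fin 2) ℂ).trace.re ≤ m₀ ^ 2 := by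
    intro e
    have h := cost_eq_opDist1_sq (W e)
    have h1 := hWm e
    have h0 := opDist1_nonneg (fundamentalRep (Fin 2) (W e))
    have : (fundamentalRep (Fin 2) (W e)) = ((W e : Matrix.specialUnitaryGroup (Fin 2) ℂ) : Matrix (Fin 2) (Fin 2) ℂ) := rfl
    rw [← this, h]
    nlinarith
  have hhalf : m₀ ^ 2 ≤ 1 / 2 := by nlinarith
  have hcoords : ∀ e, ∃ v : Fin 3 → ℝ, gnomonicChart v = W e ∧ ∑ c, v c ^ 2 ≤ 2 * m₀ ^ 2 := by
    intro e
    obtain ⟨v, hv, hvb⟩ := exists_gnomonic_coords (W e) ((hcostW e).trans hhalf)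
    exact ⟨v, hv, hvb.trans (by linarith [hcostW e])⟩
  choose v hv hvb using hcoords
  refine ⟨g, v, fun e _ => (hv e).symm, fun e _ => hvb e, ?_⟩
  -- energy
  have hm : Real.sqrt 2 * m₀ ≤ 1 / 4 := by
    have h2 : Real.sqrt 2 ≤ 3 / 2 := by
      rw [Real.sqrt_le_left (by norm_num)]; norm_num
    nlinarith [Real.sqrt_nonneg 2]
  have hm0 : 0 ≤ Real.sqrt 2 * m₀ := by positivity
  have hsq : (Real.sqrt 2 * m₀) ^ 2 = 2 * m₀ ^ 2 := by
    rw [mul_pow, Real.sq_sqrt (by norm_num : (0 : ℝ) ≤ 2)]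
  have henergy := sum_formM_coords_le H W v hm0 hm (fun e _ => (hv e).symm) (fun e _ => by rw [hsq]; exact hvb e)
  refine henergy.trans ?_
  -- the plaquette costs of `W` on the enlarged box are those of `ω`, at most `β^{2δ-1}`
  have hcost : ∀ p ∈ plaquettesIn (halfOpenBox 4 (2 * H + 3)),
      plaqCostAt (fundamentalRep (Fin 2)) (Plaq.shift dirCorner p).1 (Plaq.shift dirCorner p).2.1 (Plaq.shift dirCorner p).2.2 W ≤
        β ^ (2 * δ - 1) := by
    intro p hp
    rw [hW, hω₁, plaqCostAt_forestFix_trunc_gauge_eq g ω hp]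
    have hij : (Plaq.shift dirCorner p).2.1 < (Plaq.shift dirCorner p).2.2 := (Plaq.mem_plaquettesIn.1 hp).2.1
    exact hω (Plaq.shift dirCorner p).1 (shift_fst_mem_corona hp) _ _ hij
  have hsum : ∑ p ∈ plaquettesIn (halfOpenBox 4 (2 * H + 3)),
      plaqCostAt (fundamentalRep (Fin 2)) (Plaq.shift dirCorner p).1 (Plaq.shift dirCorner p).2.1 (Plaq.shift dirCorner p).2.2 W ≤
      (plaquettesIn (halfOpenBox 4 (2 * H + 3))).card * β ^ (2 * δ - 1) := by
    calc _ ≤ ∑ _p ∈ plaquettesIn (halfOpenBox 4 (2 * H + 3)), β ^ (2 * δ - 1) := Finset.sum_le_sum hcost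
      _ = _ := by rw [Finset.sum_const, nsmul_eq_mul]
  rw [mul_add]
  linarith [hsum]

end Summit.QuantumFields.YangMills.Theorems.WeakCouplingRates

end
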